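import Summits.BirchSwinnertonDyer.BirchSwinnertonDyer.Theses.LeadingTerm
import Literature.NumberTheory.EllipticCurves.IwasawaSelmer
import Literature.NumberTheory.EllipticCurves.IwasawaLeadingTerm
import Literature.NumberTheory.EllipticCurves.CanonicalPAdicHeightHolds

/-!
# Crux idea sketch — `PinchPrime` (stmt-BirchSwinnertonDyer-16218), ideator 2, round 1

First lemmas for the card `first-layer-stability-sharp-pinch`:

* `SharpAt` / `SharpPrime` — the transfer `C⁺`: at one good ordinary `p ≥ 5` the cyclotomic
  `p`-adic `L`-function of the newform is `T^{rank} · (unit of ℤ_p⟦T⟧)` ("sharp prime":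
  `μ = 0`, `λ = rank_ℤ E(ℚ)`).
* `order_eq_of_sharpAt` — sharp ⟹ `ord_T L_p = rank` (pure power-series bookkeeping, PROVED).
* `pinchPrime_of_sharpPrime` — `SharpPrime → PinchPrime` (PROVED; the canonical datum is the
  tree theorem `exists_isCanonical_holds`).
* `X_smul_eq_bot_of_le_omega_smul` — the NAKAYAMA STEP of the lever, PROVED: for a finitely
  generated `Λ`-module, `T·M ⊆ ω₁·M ⟹ T·M = 0`.
* `charIdeal_eq_of_firstLayerStable` — the LEVER (signature only): first-layer Selmer
  stability `Sel_{p^∞}(E/ℚ₁) = Sel_{p^∞}(E/ℚ)` plus `Ш(E/ℚ)[p^∞] = 0` forces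
  `X(E/ℚ_∞) ≅ (Λ/T)^r`, i.e. `char X = (T^r)` — Schneider non-degeneracy, `Ш`-finiteness and
  exact order at once (Nakayama on `T·X = ν₁·T·X`).
* `CofiniteShaFinite`, `StableInfinitelyOften`, `CofiniteIMC` — the asymmetric quantifier split;
  `pinchPrime_of_split` — the assembly, PROVED.
-/

noncomputable section

set_option linter.dupNamespace false

namespace Summit.BirchSwinnertonDyer.BirchSwinnertonDyer.Cruxes.PinchPrime.FirstLayerStability

open scoped MatrixGroups ModularForm
open CongruenceSubgroup Literature.NumberTheory.EllipticCurves
  Literature.NumberTheory.EllipticCurves.ModularForms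
open Summit.BirchSwinnertonDyer.BirchSwinnertonDyer.Theses

/-- `SharpAt W p f`: the cyclotomic `p`-adic `L`-function of the newform `f` of `W` at the unit
root is `T^{rank_ℤ W(ℚ)}` times a unit of `ℤ_p⟦T⟧` (equivalently `μ = 0 ∧ λ = rank`). -/
def SharpAt (W : WeierstrassCurve ℚ) [W.IsGloballyMinimal] (p : ℕ) [Fact p.Prime]
    {N : ℕ} (f : CuspForm (Gamma0 N) 2) : Prop :=
  ∃ u : PowerSeries ℤ_[p], IsUnit u ∧
    padicLFunction f (unitRoot W p : ℚ_[p]) =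
      PowerSeries.X ^ W.mordellWeilRank * PowerSeries.map (algebraMap ℤ_[p] ℚ_[p]) u

/-- The transfer `C⁺`: every elliptic `E/ℚ` (globally minimal `W`) has ONE sharp good ordinary
prime `p ≥ 5`. -/
def SharpPrime : Prop :=
  ∀ (W : WeierstrassCurve ℚ) [W.IsElliptic] [W.IsGloballyMinimal],
    ∃ (p : ℕ) (_ : Fact p.Prime), 5 ≤ p ∧ IsOrdinaryAt W p ∧
      ∃ (N : ℕ) (_ : NeZero N) (f : CuspForm (Gamma0 N) 2), IsNewformOf W f ∧ SharpAt W p f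

/-- Sharp ⟹ pinched: `ord_T (T^r · u) = r` for `u(0) ∈ ℤ_pˣ`. -/
theorem order_eq_of_sharpAt (W : WeierstrassCurve ℚ) [W.IsGloballyMinimal] (p : ℕ) [Fact p.Prime]
    {N : ℕ} (f : CuspForm (Gamma0 N) 2) (h : SharpAt W p f) :
    (padicLFunction f (unitRoot W p : ℚ_[p])).order = W.mordellWeilRank := by
  obtain ⟨u, hu, hL⟩ := h
  have hu0 : PowerSeries.coeff 0 (PowerSeries.map (algebraMap ℤ_[p] ℚ_[p]) u) ≠ 0 := by
    rw [PowerSeries.coeff_map]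
    have h1 : IsUnit (PowerSeries.constantCoeff u) := PowerSeries.isUnit_constantCoeff u hu
    rw [← PowerSeries.coeff_zero_eq_constantCoeff_apply] at h1
    intro h0
    rw [map_eq_zero_iff _ (IsFractionRing.injective ℤ_[p] ℚ_[p])] at h0
    exact h1.ne_zero h0
  have hord_u : (PowerSeries.map (algebraMap ℤ_[p] ℚ_[p]) u).order = 0 := by
    rw [show (0 : ℕ∞) = ((0 : ℕ) : ℕ∞) from Nat.cast_zero.symm, PowerSeries.order_eq_nat]
    exact ⟨hu0, fun i hi => absurd hi (Nat.not_lt_zero i)⟩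
  rw [hL, PowerSeries.order_mul, PowerSeries.order_X_pow, hord_u, add_zero]

/-- `C⁺ ⟹ C`: a sharp prime is a pinch prime (the canonical height datum demanded by the crux
exists at every good ordinary `p ≥ 5`, tree theorem `exists_isCanonical_holds`). -/
theorem pinchPrime_of_sharpPrime (h : SharpPrime) : LeadingTerm.PinchPrime := by
  intro W _ _
  obtain ⟨p, hp, h5, hord, N, hN, f, hf, hsharp⟩ := h W
  obtain ⟨D, hD⟩ := WeierstrassCurve.exists_isCanonical_holds W p h5 hord.1 hord.2
  exact ⟨p, hp, h5, hord, D, hD, N, hN, f, hf, order_eq_of_sharpAt W p f hsharp⟩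

/-- First-layer Selmer stability at `p` along the cyclotomic `ℤ_p`-extension `κ`: the images of
`Sel_{p^∞}(E/ℚ₁)` and `Sel_{p^∞}(E/ℚ)` in `Sel_{p^∞}(E/ℚ_∞)` coincide (no new Selmer in the first
layer `ℚ₁ = ℚ_∞^{Γ^p}`, the degree-`p` subfield of `ℚ(μ_{p²})`). -/
def FirstLayerStable (W : WeierstrassCurve ℚ) {p : ℕ} [Fact p.Prime] (κ : ZpExtension ℚ p) :
    Prop :=
  (W.selmerLayer κ 1).map (W.layerToInfty κ 1) = (W.selmerLayer κ 0).map (W.layerToInfty κ 0)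

/-- THE LEVER (signature): at a good ordinary non-anomalous `p ≥ 5` with `p ∤ ∏ c_v` and
`E(ℚ)[p] = 0`, first-layer stability plus FINITENESS of `Ш(E/ℚ)[p^∞]` gives
`char X(E/ℚ_∞) = (T^{rank})` (indeed `X ≅ (Λ/T)^{rank} ⊕ (finite)`: exact control at levels 0, 1
(GreenbergLNM1716 §3) identifies `X/ω₁X → X/TX` with the dual of `Sel(ℚ) → Sel(ℚ₁)`, stability
makes it an isomorphism, so `T·X = ω₁·X = ν₁·(T·X)` with `ν₁ = ω₁/T ∈ (p,T)`, and Nakayama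
kills `T·X`; then `X = Sel_{p^∞}(E/ℚ)^∨ ≅ ℤ_p^r ⊕ Ш[p^∞]^∨` with `T = 0`). Schneider
non-degeneracy, exactness `ord_T f_E = r` and `μ = 0, λ = r` are COROLLARIES. -/
theorem charIdeal_eq_of_firstLayerStable
    (W : WeierstrassCurve ℚ) [W.IsElliptic] [W.IsGloballyMinimal] (p : ℕ) [Fact p.Prime]
    (hp : 5 ≤ p) (hgood : W.HasGoodReductionAtPrime p) (hord : ¬ (p : ℤ) ∣ W.frobeniusTrace p)
    (hanom : ¬ (p : ℤ) ∣ W.frobeniusTrace p - 1) (htam : ¬ p ∣ W.tamagawaProduct)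
    (htors : ∀ P : W.toAffine.Point, p • P = 0 → P = 0)
    {κ : ZpExtension ℚ p} {γ : Field.absoluteGaloisGroup ℚ}
    (hκ : κ.IsCyclotomic) (hγ : κ.IsTopGenerator γ)
    (D : W.SelmerDualData κ γ) [Module.Finite (IwasawaAlgebra p) D.X]
    (hsha : Finite (AddCommGroup.primaryComponent W.sha p))
    (hstab : FirstLayerStable W κ) :
    D.charIdeal = Ideal.span {(PowerSeries.X : IwasawaAlgebra p) ^ W.mordellWeilRank} := by
  sorry

/-- THE NAKAYAMA STEP OF THE LEVER (pure `Λ`-algebra, PROVED): if `T·M ⊆ ω₁·M` for a finitely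
generated `Λ`-module `M` (`ω₁ = (1+T)^p − 1 = ν₁·T`, `ν₁(0) = p ∈ 𝔪`), then `T·M = 0`. Applied to
`M = X(E/ℚ_∞)`, where "`X/ω₁X → X/TX` is an isomorphism" is first-layer Selmer stability read
through exact control, it gives `T·X = 0`, i.e. `X = Sel_{p^∞}(E/ℚ)^∨` with trivial `Γ`-action. -/
theorem X_smul_eq_bot_of_le_omega_smul {p : ℕ} [Fact p.Prime] (M : Type*) [AddCommGroup M]
    [Module (IwasawaAlgebra p) M] [Module.Finite (IwasawaAlgebra p) M]
    (h : (Ideal.span {(PowerSeries.X : IwasawaAlgebra p)}) • (⊤ : Submodule (IwasawaAlgebra p) M)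
        ≤ (Ideal.span {((1 + PowerSeries.X : IwasawaAlgebra p) ^ p - 1)}) • ⊤) :
    (Ideal.span {(PowerSeries.X : IwasawaAlgebra p)}) • (⊤ : Submodule (IwasawaAlgebra p) M)
      = ⊥ := by
  set N := (Ideal.span {(PowerSeries.X : IwasawaAlgebra p)}) • (⊤ : Submodule (IwasawaAlgebra p) M)
    with hN
  set ν : IwasawaAlgebra p := ∑ i ∈ Finset.range p, (1 + PowerSeries.X) ^ i with hν
  have hω : ((1 + PowerSeries.X : IwasawaAlgebra p) ^ p - 1) = ν * PowerSeries.X := by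
    have := geom_sum_mul (1 + PowerSeries.X : IwasawaAlgebra p) p
    rw [add_sub_cancel_left] at this
    exact this.symm
  have hle : N ≤ (Ideal.span {ν}) • N := by
    calc N ≤ (Ideal.span {((1 + PowerSeries.X : IwasawaAlgebra p) ^ p - 1)}) • ⊤ := h
      _ = (Ideal.span {ν} * Ideal.span {(PowerSeries.X : IwasawaAlgebra p)}) •
            (⊤ : Submodule (IwasawaAlgebra p) M) := by
          rw [hω, Ideal.span_singleton_mul_span_singleton]
      _ = (Ideal.span {ν}) • N := by rw [hN, Submodule.mul_smul]
  have hνmax : ν ∈ IsLocalRing.maximalIdeal (IwasawaAlgebra p) := by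
    rw [IsLocalRing.mem_maximalIdeal, mem_nonunits_iff, PowerSeries.isUnit_iff_constantCoeff]
    have hc : PowerSeries.constantCoeff ν = (p : ℤ_[p]) := by
      simp [hν, map_sum]
    rw [hc]
    exact PadicInt.p_nonunit
  have hjac : Ideal.span {ν} ≤ (⊥ : Ideal (IwasawaAlgebra p)).jacobson := by
    rw [IsLocalRing.jacobson_eq_maximalIdeal ⊥ bot_ne_top, Ideal.span_le, Set.singleton_subset_iff]
    exact hνmax
  have hfg : N.FG := IsNoetherian.noetherian N
  exact Submodule.eq_bot_of_le_smul_of_le_jacobson_bot (Ideal.span {ν}) N hfg hle hjac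

/-- Split, `Ш`-side (cofinite): `Ш(E/ℚ)[p^∞]` is FINITE for all but finitely many good ORDINARY
`p` (⟸ finiteness of `Ш`, strictly weaker; known when `r_an ≤ 1`, Kolyvagin). -/
def CofiniteShaFinite : Prop :=
  ∀ (W : WeierstrassCurve ℚ) [W.IsElliptic] [W.IsGloballyMinimal],
    ∃ B : Finset ℕ, ∀ p ∉ B, ∀ [Fact p.Prime], IsOrdinaryAt W p →
      Finite (AddCommGroup.primaryComponent W.sha p)

/-- Split, height-side (infinitely often): infinitely many good ordinary non-anomalous primes
`p ∤ ∏ c_v` at which the first cyclotomic layer is Selmer-stable (the mod-`p` cyclotomic Bockstein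
on `Sel_p(E/ℚ)` is non-degenerate: "the Mordell–Weil lattice is not Wieferich at `p`"). NO image
hypothesis (CM-safe: the refuted `TamePinch`, stmt-15532, died on `∃ p, ρ̄ surjective` at CM curves);
the main conjecture enters the glue separately and cofinitely (`CofiniteIMC`). -/
def StableInfinitelyOften : Prop :=
  ∀ (W : WeierstrassCurve ℚ) [W.IsElliptic] [W.IsGloballyMinimal], ∀ B : Finset ℕ,
    ∃ p ∉ B, ∃ _ : Fact p.Prime, 5 ≤ p ∧ IsOrdinaryAt W p ∧
      ¬ (p : ℤ) ∣ W.frobeniusTrace p - 1 ∧ ¬ p ∣ W.tamagawaProduct ∧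
      ∃ κ : ZpExtension ℚ p, κ.IsCyclotomic ∧ FirstLayerStable W κ

/-- Glue input, cofinite: the cyclotomic main conjecture `char X(E/ℚ_∞) = (L_p)` (as ideals of
`Λ ⊗ ℚ_p`, enough for orders of vanishing) at all but finitely many good ordinary `p` — non-CM:
Serre's open image + Kato2004 + SkinnerUrban2014 / BCS2025; CM: Rubin1991. Stated abstractly as
"`ord_T L_p = ord_T f_E`". -/
def CofiniteIMC : Prop :=
  ∀ (W : WeierstrassCurve ℚ) [W.IsElliptic] [W.IsGloballyMinimal],
    ∃ B : Finset ℕ, ∀ p ∉ B, ∀ [Fact p.Prime], 5 ≤ p → IsOrdinaryAt W p →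
      ∀ (κ : ZpExtension ℚ p) (γ : Field.absoluteGaloisGroup ℚ),
        κ.IsCyclotomic → κ.IsTopGenerator γ →
      ∀ (D : W.SelmerDualData κ γ) [Module.Finite (IwasawaAlgebra p) D.X] (fE : IwasawaAlgebra p),
        D.charIdeal = Ideal.span {fE} →
      ∀ {N : ℕ} [NeZero N] (f : CuspForm (Gamma0 N) 2), IsNewformOf W f →
        (padicLFunction f (unitRoot W p : ℚ_[p])).order = fE.order

/-- The lever in closed (∀) form, for the assembly. -/
def FirstLayerLever : Prop :=
  ∀ (W : WeierstrassCurve ℚ) [W.IsElliptic] [W.IsGloballyMinimal] (p : ℕ) [Fact p.Prime],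
    5 ≤ p → W.HasGoodReductionAtPrime p → ¬ (p : ℤ) ∣ W.frobeniusTrace p →
    ¬ (p : ℤ) ∣ W.frobeniusTrace p - 1 → ¬ p ∣ W.tamagawaProduct →
    (∀ P : W.toAffine.Point, p • P = 0 → P = 0) →
    ∀ {κ : ZpExtension ℚ p} {γ : Field.absoluteGaloisGroup ℚ},
      κ.IsCyclotomic → κ.IsTopGenerator γ →
    ∀ (D : W.SelmerDualData κ γ) [Module.Finite (IwasawaAlgebra p) D.X],
      Finite (AddCommGroup.primaryComponent W.sha p) → FirstLayerStable W κ →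
      D.charIdeal = Ideal.span {(PowerSeries.X : IwasawaAlgebra p) ^ W.mordellWeilRank}

/-- ASSEMBLY (PROVED): cofinite `Ш[p^∞]`-finiteness ∧ infinitely many stable primes ∧ cofinite
IMC ∧ the lever ⟹ `PinchPrime` (pick a stable prime outside the three finite exceptional sets and
the torsion primes; `char X = (T^r)` and `ord_T L_p = ord_T T^r = r`). Existence of the Iwasawa
datum (`nonempty_selmerDualData`, Kato's `module_finite`), cofinite `p`-torsion-freeness of `E(ℚ)`
(Mordell–Weil) and modularity (`exists_isNewformOf`, for the `∃ f` clause of the crux) are tree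
facts/named facts, taken here as hypotheses `hD`, `hTor`, `hmod`. -/
theorem pinchPrime_of_split (hSha : CofiniteShaFinite) (hSt : StableInfinitelyOften)
    (hIMC : CofiniteIMC) (hL : FirstLayerLever)
    (hD : ∀ (W : WeierstrassCurve ℚ) [W.IsElliptic] [W.IsGloballyMinimal] (p : ℕ) [Fact p.Prime]
      (κ : ZpExtension ℚ p), κ.IsCyclotomic →
      ∃ (γ : Field.absoluteGaloisGroup ℚ) (D : W.SelmerDualData κ γ),
        κ.IsTopGenerator γ ∧ Module.Finite (IwasawaAlgebra p) D.X)
    (hTor : ∀ (W : WeierstrassCurve ℚ) [W.IsElliptic], ∃ B : Finset ℕ, ∀ p ∉ B,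
      ∀ P : W.toAffine.Point, p • P = 0 → P = 0)
    (hmod : exists_isNewformOf) :
    LeadingTerm.PinchPrime := by
  intro W _ _
  obtain ⟨B₁, hB₁⟩ := hSha W
  obtain ⟨B₂, hB₂⟩ := hIMC W
  obtain ⟨B₃, hB₃⟩ := hTor W
  obtain ⟨p, hpB, hp, h5, hord, hanom, htam, κ, hκ, hstab⟩ := hSt W (B₁ ∪ B₂ ∪ B₃)
  simp only [Finset.mem_union, not_or] at hpB
  obtain ⟨⟨hp1, hp2⟩, hp3⟩ := hpB
  haveI : Fact p.Prime := hp
  obtain ⟨γ, D, hγ, hfin⟩ := hD W p κ hκ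
  haveI : Module.Finite (IwasawaAlgebra p) D.X := hfin
  have hchar : D.charIdeal = Ideal.span {(PowerSeries.X : IwasawaAlgebra p) ^ W.mordellWeilRank} :=
    hL W p h5 hord.1 hord.2 hanom htam (hB₃ p hp3) hκ hγ D (hB₁ p hp1 hord) hstab
  haveI : NeZero (W.conductorNorm ℤ) := ⟨(WeierstrassCurve.conductorNorm_pos_holds (W := W)).ne'⟩
  obtain ⟨f, hf⟩ := hmod W
  have horder : (padicLFunction f (unitRoot W p : ℚ_[p])).order = W.mordellWeilRank := by
    rw [hB₂ p hp2 h5 hord κ γ hκ hγ D _ hchar f hf, PowerSeries.order_X_pow]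
  obtain ⟨Dh, hDh⟩ := WeierstrassCurve.exists_isCanonical_holds W p h5 hord.1 hord.2
  exact ⟨p, hp, h5, hord, Dh, hDh, _, inferInstance, f, hf, horder⟩

end Summit.BirchSwinnertonDyer.BirchSwinnertonDyer.Cruxes.PinchPrime.FirstLayerStability

end
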